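/-
[OURS · L1 W4.5(b) · EL♮(3)] SPECIMEN-TC⁺ (quartic, one inner step (i)) — GLOBAL THREE-STEP REGULARITY (point, inner point, curve).
-/
import Summits.ResolutionOfSingularities.ResolutionOfSingularities.Theorems.EquisingularLiftEquisingularLiftNatSpecimenQuarticTcPlusInnerTwoStepGlobal
import Summits.ResolutionOfSingularities.ResolutionOfSingularities.Theorems.EquisingularLiftEquisingularLiftNatSpecimenQuarticTcPlusInnerStep
import Summits.ResolutionOfSingularities.ResolutionOfSingularities.Theorems.EquisingularLiftEquisingularLiftNatSpecimenQuarticTcDeltaTwoStepGlobal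
import Literature.AlgebraicGeometry.Resolution.BlowupsExistence
import HarnessLib

/-!
# [OURS · L1 W4.5(b) · EL♮(3)] SPECIMEN-TC⁺ for the quartic — part TG: GLOBAL THREE-STEP REGULARITY
# (point `y₀`, then the inner point `y₁` of the carrier line, then the strict transform of the carrier line)
# (crux `EquisingularLiftNatThree` = stmt-ResolutionOfSingularities-20148; res-L1-w45b-lead-2 DEALS (D2) 2026-08-27T11:55:26Z «NON-VACUITY
# CERTIFICATES TC⁺»; scoping memo D/res-D-pv-034/SPECIMEN-TCPLUS-SCOPE.md §5 (β3); helper, closes nothing)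

HONEST FRAMING. OURS (cell `res-hironaka`, chain w45b, slot W4.5(b)); NOT a statement of any manuscript; AI-written, weaker than expert review.

Setting: `…TcDeltaTwoStepGlobal`'s (chart `w`, closed irreducible `T` with `𝓘_T · 𝒪 = (z² + x⁴ + y⁴)~`, `y₀ = w(o)`, blow-up `β` at `y₀`,
`S′ = closure β⁻¹(T ∖ {y₀})`, `Z = β⁻¹{y₀} ∩ S′`) PLUS an inner chart `w₁ : Spec k[X] → Y′` centred at `y₁ = w₁(o) ∈ Z` with `𝓘_{S′} · 𝒪 = (gL)~`,
`𝓘_Z · 𝒪 = (X₁, X₂)~` (`…TcPlusInnerStage.exists_innerChart`), the blow-up `βᵢ : Y″ → Y′` at `y₁` and the blow-up `β′ : Y‴ → Y″` along the ideal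
sheaf of the reduced strict transform `Z₉ = closure βᵢ⁻¹(Z ∖ {y₁})`. RESULT: the reduced strict transform `Γ‴ = V(closure T‴)_red`,
`T‴ = closure β′⁻¹(closure βᵢ⁻¹(S′ ∖ {y₁}) ∖ Z₉)`, is REGULAR (1) at every point over the chart `w` (`isRegularLocalRing_threeStep_of_mem_range`) and
(2) at every point over an open `O ∌ y₀` over which `Γ = V(closure T)_red` is regular (`isRegularLocalRing_threeStep_of_mem_open`).
MECHANISM. (1): a point over `y₁` is handled by `…TcPlusInnerTwoStepGlobal`; a point NOT over `y₁` lies over the open `β⁻¹w(Spec k[X]) ∖ {y₁}`,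
where `βᵢ` is an isomorphism and `β′` is a blow-up along `𝓘_Z` — so by `IsBlowup.unique` the situation is isomorphic to ANY blow-up
`μ : M → Y′` along `𝓘_Z` (`exists_isBlowup`), whose reduced strict transform is regular there by `…TcDeltaTwoStepGlobal`
(`…TcPlusRegularityTransport`). (2): three times «a blow-up is an isomorphism off its centre».

References: Stacks 080E; Görtz–Wedhorn I (13.19), Prop. 13.91; Hartshorne II 7.13–7.16 (via the cited tree files).
-/

set_option linter.dupNamespace false -- mandated namespace `Summit.<Summit>.<Problem>` of this single-conjunct summit

noncomputable section

open CategoryTheory CategoryTheory.Limits AlgebraicGeometry TopologicalSpace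
open MvPolynomial
open AlgebraicGeometry.Scheme.IdealSheafData
open Literature.AlgebraicGeometry.Resolution
open Summit.ResolutionOfSingularities.ResolutionOfSingularities.Theorems.EquisingularLift

namespace Summit.ResolutionOfSingularities.ResolutionOfSingularities.Cruxes.EquisingularLiftNat.Sections

namespace SpecimenQuarticTcPlus

open SpecimenQuarticTcDelta

section ThreeStep

variable {k : Type} [Field k] [IsAlgClosed k]
variable {Y Y' Y'' Y''' : Scheme.{0}} [IsLocallyNoetherian Y]
  (w : Spec (CommRingCat.of (MvPolynomial (Fin 3) k)) ⟶ Y) [IsOpenImmersion w]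
  (hc : IsClosed ({w (o k)} : Set Y))
  {T : Set Y} (hTc : IsClosed T) (hTirr : IsIrreducible T)
  (hwT : (vanishingIdeal (⟨T, hTc⟩ : Closeds Y)).comap w =
    ofIdealTop ((Ideal.span {(X 2 ^ 2 + X 0 ^ 4 + X 1 ^ 4 : MvPolynomial (Fin 3) k)}).map
      (Scheme.ΓSpecIso (CommRingCat.of (MvPolynomial (Fin 3) k))).inv.hom))
  (hwo : w (o k) ∈ T) (h2 : (2 : k) ≠ 0)
  {β : Y' ⟶ Y} (hβ : IsBlowup β (vanishingIdeal (⟨{w (o k)}, hc⟩ : Closeds Y)))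
  (w₁ : Spec (CommRingCat.of (MvPolynomial (Fin 3) k)) ⟶ Y') [IsOpenImmersion w₁]
  (hc₁ : IsClosed ({w₁ (o k)} : Set Y'))
  (hw₁S : (vanishingIdeal (⟨closure (β ⁻¹' (T \ {w (o k)})), isClosed_closure⟩ : Closeds Y')).comap w₁ =
    ofIdealTop ((Ideal.span {gL k}).map (Scheme.ΓSpecIso (CommRingCat.of (MvPolynomial (Fin 3) k))).inv.hom))
  (hw₁Z : (vanishingIdeal (⟨β ⁻¹' {w (o k)} ∩ closure (β ⁻¹' (T \ {w (o k)})), isClosed_inter hc β⟩ : Closeds Y')).comap w₁ =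
    ofIdealTop ((Ideal.span (Set.range (WhitneyCubic.cen k))).map (Scheme.ΓSpecIso (CommRingCat.of (MvPolynomial (Fin 3) k))).inv.hom))
  (hw₁o : w₁ (o k) ∈ β ⁻¹' {w (o k)} ∩ closure (β ⁻¹' (T \ {w (o k)})))
  {βᵢ : Y'' ⟶ Y'} (hβᵢ : IsBlowup βᵢ (vanishingIdeal (⟨{w₁ (o k)}, hc₁⟩ : Closeds Y')))
  {β' : Y''' ⟶ Y''}
  (hβ' : IsBlowup β' (vanishingIdeal (⟨closure (βᵢ ⁻¹' ((β ⁻¹' {w (o k)} ∩ closure (β ⁻¹' (T \ {w (o k)}))) \ {w₁ (o k)})),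
    isClosed_closure⟩ : Closeds Y'')))

include hTirr hwT hwo h2 hβ hw₁S hw₁Z hw₁o hβᵢ hβ' in
/-- **GLOBAL THREE-STEP REGULARITY (1)**: the reduced third strict transform `V(closure T‴)_red` is regular at every point over the chart
`w(Spec k[X])`. [OURS · L1 W4.5b · SPECIMEN-TC⁺ (i)] [cite: StacksProject, Tag 080E] -/
theorem isRegularLocalRing_threeStep_of_mem_range :
    ∀ z : (vanishingIdeal (⟨closure (β' ⁻¹' (closure (βᵢ ⁻¹' (closure (β ⁻¹' (T \ {w (o k)})) \ {w₁ (o k)})) \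
      closure (βᵢ ⁻¹' ((β ⁻¹' {w (o k)} ∩ closure (β ⁻¹' (T \ {w (o k)}))) \ {w₁ (o k)})))), isClosed_closure⟩ : Closeds Y''')).subscheme,
    β (βᵢ (β' ((vanishingIdeal (⟨closure (β' ⁻¹' (closure (βᵢ ⁻¹' (closure (β ⁻¹' (T \ {w (o k)})) \ {w₁ (o k)})) \
      closure (βᵢ ⁻¹' ((β ⁻¹' {w (o k)} ∩ closure (β ⁻¹' (T \ {w (o k)}))) \ {w₁ (o k)})))), isClosed_closure⟩ : Closeds Y''')).subschemeι z))) ∈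
      Set.range w →
    IsRegularLocalRing ((vanishingIdeal (⟨closure (β' ⁻¹' (closure (βᵢ ⁻¹' (closure (β ⁻¹' (T \ {w (o k)})) \ {w₁ (o k)})) \
      closure (βᵢ ⁻¹' ((β ⁻¹' {w (o k)} ∩ closure (β ⁻¹' (T \ {w (o k)}))) \ {w₁ (o k)})))), isClosed_closure⟩ :
        Closeds Y''')).subscheme.presheaf.stalk z) := by
  -- ### names
  set y₀ : Y := w (o k) with hy₀
  set y₁ : Y' := w₁ (o k) with hy₁
  set S' : Set Y' := closure (β ⁻¹' (T \ {y₀})) with hS'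
  set Z : Set Y' := β ⁻¹' {y₀} ∩ S' with hZ
  set T'' : Set Y'' := closure (βᵢ ⁻¹' (S' \ {y₁})) with hT''
  set Z₉ : Set Y'' := closure (βᵢ ⁻¹' (Z \ {y₁})) with hZ₉
  set T''' : Set Y''' := closure (β' ⁻¹' (T'' \ Z₉)) with hT'''
  have hZc : IsClosed Z := isClosed_inter hc β
  haveI : IsLocallyNoetherian Y' := hβ.isLocallyNoetherian
  haveI : IsLocallyNoetherian Y'' := hβᵢ.isLocallyNoetherian
  have h2' : IsUnit (2 : k) := isUnit_iff_ne_zero.mpr h2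
  -- ### standing facts about `S'` and `Z`
  have hux : (vanishingIdeal (⟨{y₀}, hc⟩ : Closeds Y)).comap w =
      ofIdealTop ((PointBlowup.originIdeal 2 k).map (Scheme.ΓSpecIso (CommRingCat.of (MvPolynomial (Fin 3) k))).inv.hom) :=
    comap_vanishingIdeal_singleton_chart w hc
  have hc₉ : ¬ S' ⊆ Z := not_strict_subset_inter w hc hux hTc hwT h2 hβ
  have hT₁ : ¬ T ⊆ {y₀} := by
    intro hsub
    apply hc₉
    have he : T \ {y₀} = ∅ := Set.sdiff_eq_empty.mpr hsub
    rw [hS', he, Set.preimage_empty, closure_empty]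
    exact Set.empty_subset _
  have hS'irr : IsIrreducible S' := isIrreducible_strictTransform_of_isBlowup ⟨{y₀}, hc⟩ hβ hTirr hT₁
  have hS₁ : ¬ S' ⊆ {y₁} := by
    intro hsub
    apply hc₉
    intro s hs
    rw [Set.mem_singleton_iff.mp (hsub hs)]
    exact hw₁o
  have hS₂ : ¬ closure (βᵢ ⁻¹' (S' \ {y₁})) ⊆ closure (βᵢ ⁻¹' (Z \ {y₁})) :=
    not_strict_subset_lineStrict w₁ hc₁ hZc hw₁o hc₉ hβᵢ
  -- ### case split: is the point over the inner centre `y₁`?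
  intro z hz
  by_cases hb : βᵢ (β' ((vanishingIdeal (⟨T''', isClosed_closure⟩ : Closeds Y''')).subschemeι z)) = y₁
  · -- over `y₁`: the global INNER two-step over the chart `w₁`
    exact isRegularLocalRing_innerTwoStep_of_mem_range w₁ rfl hc₁ isClosed_closure hS'irr hw₁S hZc Set.inter_subset_right hw₁Z hw₁o
      h2' hS₁ hβᵢ hS₂ hβ' z (by rw [hb]; exact ⟨o k, rfl⟩)
  · -- off `y₁`: compare with a model blow-up `μ : M → Y′` along `𝓘_Z` over `O = β⁻¹ w(Spec k[X]) ∖ {y₁}`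
    obtain ⟨M, μ, hμ⟩ := exists_isBlowup Y' (vanishingIdeal (⟨Z, hZc⟩ : Closeds Y'))
    let O : Y'.Opens := ⟨β ⁻¹' Set.range w ∩ {y₁}ᶜ, (w.isOpenEmbedding.isOpen_range.preimage β.continuous).inter hc₁.isOpen_compl⟩
    have hOy₁ : ({y₁} : Set Y') ∩ (O : Set Y') = ∅ := by
      ext y; simp only [Set.mem_inter_iff, Set.mem_singleton_iff, Set.mem_empty_iff_false, iff_false, not_and]
      rintro rfl h; exact h.2 rfl
    haveI : IsIso (βᵢ ∣_ O) := hβᵢ.isIso_morphismRestrict (by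
      rw [Scheme.IdealSheafData.coe_support_vanishingIdeal]
      exact Set.disjoint_left.mpr fun y hy hy1 => hy.2 hy1)
    -- the strict transforms over `O`
    have hT''O : T'' ∩ βᵢ ⁻¹' (O : Set Y') = βᵢ ⁻¹' S' ∩ βᵢ ⁻¹' (O : Set Y') :=
      strictTransform_inter_preimage_eq βᵢ O.2 isClosed_closure rfl hOy₁
    have hZ₉O : Z₉ ∩ βᵢ ⁻¹' (O : Set Y') = βᵢ ⁻¹' Z ∩ βᵢ ⁻¹' (O : Set Y') :=
      strictTransform_inter_preimage_eq βᵢ O.2 hZc rfl hOy₁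
    -- the centre of `β′` over `O` is the pull-back of `𝓘_Z`
    have hC : (vanishingIdeal (⟨Z₉, isClosed_closure⟩ : Closeds Y'')).comap (βᵢ ⁻¹ᵁ O).ι =
        ((vanishingIdeal (⟨Z, hZc⟩ : Closeds Y')).comap O.ι).comap (βᵢ ∣_ O) := by
      rw [← Scheme.IdealSheafData.comap_comp, comap_vanishingIdeal_of_isOpenImmersion,
        comap_vanishingIdeal_of_isOpenImmersion ((βᵢ ∣_ O) ≫ O.ι)]
      congr 1
      apply Closeds.ext
      change (βᵢ ⁻¹ᵁ O).ι ⁻¹' Z₉ = ((βᵢ ∣_ O) ≫ O.ι) ⁻¹' Z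
      ext u
      have hu : βᵢ ((βᵢ ⁻¹ᵁ O).ι u) ∈ (O : Set Y') := u.2
      have hval : ((βᵢ ∣_ O) ≫ O.ι) u = βᵢ ((βᵢ ⁻¹ᵁ O).ι u) := by
        rw [Scheme.Hom.comp_apply, Scheme.Opens.ι_apply, Scheme.Opens.ι_apply, morphismRestrict_base_coe]
      have h1 := Set.ext_iff.mp hZ₉O ((βᵢ ⁻¹ᵁ O).ι u)
      simp only [Set.mem_inter_iff, Set.mem_preimage] at h1
      rw [Set.mem_preimage, Set.mem_preimage, hval]
      exact ⟨fun h => (h1.mp ⟨h, hu⟩).1, fun h => (h1.mpr ⟨h, hu⟩).1⟩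
    obtain ⟨e, he⟩ := exists_iso_of_isBlowup_restrict βᵢ O β' _ hβ' _ hC μ hμ
    -- the traces of the strict transforms correspond under `e`
    have hset : e.hom ⁻¹' ((μ ⁻¹ᵁ O).ι ⁻¹' closure (μ ⁻¹' (S' \ Z))) = (β' ⁻¹ᵁ (βᵢ ⁻¹ᵁ O)).ι ⁻¹' T''' := by
      rw [preimage_ι_closure_preimage_diff' μ O, hT''', preimage_ι_closure_preimage_diff βᵢ O β' hT''O hZ₉O, ← he,
        e.hom.isOpenEmbedding.isOpenMap.preimage_closure_eq_closure_preimage (Scheme.Hom.continuous e.hom)]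
      congr 1
    -- the model is regular over `O` by the global TWO-step
    have hregM : ∀ m : (vanishingIdeal (⟨closure (μ ⁻¹' (S' \ Z)), isClosed_closure⟩ : Closeds M)).subscheme,
        μ ((vanishingIdeal (⟨closure (μ ⁻¹' (S' \ Z)), isClosed_closure⟩ : Closeds M)).subschemeι m) ∈ O →
        IsRegularLocalRing ((vanishingIdeal (⟨closure (μ ⁻¹' (S' \ Z)), isClosed_closure⟩ : Closeds M)).subscheme.presheaf.stalk m) :=
      fun m hm => isRegularLocalRing_twoStep_of_mem_range w rfl hc hTc hTirr hwT hwo h2 hβ hμ m hm.1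
    refine isRegularLocalRing_subscheme_of_iso_pieces βᵢ O β' μ e isClosed_closure isClosed_closure hset hregM z ⟨?_, hb⟩
    change β (βᵢ (β' _)) ∈ Set.range w
    exact hz

omit [IsAlgClosed k] [IsLocallyNoetherian Y] [IsOpenImmersion w] [IsOpenImmersion w₁] in
include hTc hβ hw₁o hβᵢ hβ' in
/-- **GLOBAL THREE-STEP REGULARITY (2)**: the reduced third strict transform is regular at every point over an open `O ∌ y₀` over which
`V(closure T)_red` is regular (all three blow-ups are isomorphisms there). [OURS · L1 W4.5b · SPECIMEN-TC⁺ (i)] [cite: GortzWedhorn2020, Prop. 13.91] -/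
theorem isRegularLocalRing_threeStep_of_mem_open (O : Y.Opens) (hO : w (o k) ∉ O)
    (hregO : ∀ x : (vanishingIdeal (⟨closure T, isClosed_closure⟩ : Closeds Y)).subscheme,
      (vanishingIdeal (⟨closure T, isClosed_closure⟩ : Closeds Y)).subschemeι x ∈ O →
      IsRegularLocalRing ((vanishingIdeal (⟨closure T, isClosed_closure⟩ : Closeds Y)).subscheme.presheaf.stalk x)) :
    ∀ z : (vanishingIdeal (⟨closure (β' ⁻¹' (closure (βᵢ ⁻¹' (closure (β ⁻¹' (T \ {w (o k)})) \ {w₁ (o k)})) \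
      closure (βᵢ ⁻¹' ((β ⁻¹' {w (o k)} ∩ closure (β ⁻¹' (T \ {w (o k)}))) \ {w₁ (o k)})))), isClosed_closure⟩ : Closeds Y''')).subscheme,
    β (βᵢ (β' ((vanishingIdeal (⟨closure (β' ⁻¹' (closure (βᵢ ⁻¹' (closure (β ⁻¹' (T \ {w (o k)})) \ {w₁ (o k)})) \
      closure (βᵢ ⁻¹' ((β ⁻¹' {w (o k)} ∩ closure (β ⁻¹' (T \ {w (o k)}))) \ {w₁ (o k)})))), isClosed_closure⟩ : Closeds Y''')).subschemeι z))) ∈ O →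
    IsRegularLocalRing ((vanishingIdeal (⟨closure (β' ⁻¹' (closure (βᵢ ⁻¹' (closure (β ⁻¹' (T \ {w (o k)})) \ {w₁ (o k)})) \
      closure (βᵢ ⁻¹' ((β ⁻¹' {w (o k)} ∩ closure (β ⁻¹' (T \ {w (o k)}))) \ {w₁ (o k)})))), isClosed_closure⟩ :
        Closeds Y''')).subscheme.presheaf.stalk z) := by
  set y₀ : Y := w (o k) with hy₀
  set y₁ : Y' := w₁ (o k) with hy₁
  set S' : Set Y' := closure (β ⁻¹' (T \ {y₀})) with hS'
  set Z : Set Y' := β ⁻¹' {y₀} ∩ S' with hZ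
  set T'' : Set Y'' := closure (βᵢ ⁻¹' (S' \ {y₁})) with hT''
  set Z₉ : Set Y'' := closure (βᵢ ⁻¹' (Z \ {y₁})) with hZ₉
  have hZc : IsClosed Z := isClosed_inter hc β
  have hβy₁ : β y₁ = y₀ := hw₁o.1
  -- step A: `β` over `O`
  let O₁ : Y'.Opens := β ⁻¹ᵁ O
  haveI : IsIso (β ∣_ O) := hβ.isIso_morphismRestrict (by
    rw [Scheme.IdealSheafData.coe_support_vanishingIdeal]
    exact Set.disjoint_singleton_right.mpr hO)
  have hA : S' ∩ β ⁻¹' (O : Set Y) = β ⁻¹' closure T ∩ β ⁻¹' (O : Set Y) :=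
    strictTransform_inter_preimage_eq β O.2 isClosed_closure (by rw [hTc.closure_eq]) (Set.singleton_inter_eq_empty.mpr hO)
  have regA := isRegularLocalRing_subscheme_of_isIso_restrict β O isClosed_closure isClosed_closure hA hregO
  -- step B: `βᵢ` over `O₁ = β⁻¹ O`
  have hO₁ : y₁ ∉ O₁ := fun h => hO (by rw [← hβy₁]; exact h)
  haveI : IsIso (βᵢ ∣_ O₁) := hβᵢ.isIso_morphismRestrict (by
    rw [Scheme.IdealSheafData.coe_support_vanishingIdeal]
    exact Set.disjoint_singleton_right.mpr hO₁)
  have hB : T'' ∩ βᵢ ⁻¹' (O₁ : Set Y') = βᵢ ⁻¹' S' ∩ βᵢ ⁻¹' (O₁ : Set Y') :=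
    strictTransform_inter_preimage_eq βᵢ O₁.2 isClosed_closure rfl (Set.singleton_inter_eq_empty.mpr hO₁)
  have regB := isRegularLocalRing_subscheme_of_isIso_restrict βᵢ O₁ isClosed_closure isClosed_closure hB regA
  -- step C: `β′` over `O₂ = βᵢ⁻¹ O₁`
  let O₂ : Y''.Opens := βᵢ ⁻¹ᵁ O₁
  have hZ₉O₂ : Z₉ ∩ (O₂ : Set Y'') = ∅ := by
    ext y
    simp only [Set.mem_inter_iff, Set.mem_empty_iff_false, iff_false, not_and]
    intro hy hyO
    have hyZ : βᵢ y ∈ Z := lineStrict_subset_preimage w₁ hZc βᵢ hy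
    have : β (βᵢ y) = y₀ := hyZ.1
    apply hO
    change β (βᵢ y) ∈ O at hyO
    rw [this] at hyO
    exact hyO
  haveI : IsIso (β' ∣_ O₂) := hβ'.isIso_morphismRestrict (by
    rw [Scheme.IdealSheafData.coe_support_vanishingIdeal, Set.disjoint_iff_inter_eq_empty, Set.inter_comm]
    exact hZ₉O₂)
  have hCstep : closure (β' ⁻¹' (T'' \ Z₉)) ∩ β' ⁻¹' (O₂ : Set Y'') = β' ⁻¹' T'' ∩ β' ⁻¹' (O₂ : Set Y'') :=
    strictTransform_inter_preimage_eq β' O₂.2 isClosed_closure rfl hZ₉O₂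
  intro z hz
  exact isRegularLocalRing_subscheme_of_isIso_restrict β' O₂ isClosed_closure isClosed_closure hCstep regB z hz

omit [IsAlgClosed k] [IsLocallyNoetherian Y] [IsOpenImmersion w] [IsOpenImmersion w₁] in
/-- The «double closure» spelling (as the TC⁺ clause iterates it) of the reduced third strict transform. [folklore] -/
theorem closeds_threeStep_eq' (β' : Y''' ⟶ Y'') :
    (⟨closure (β' ⁻¹' (closure (βᵢ ⁻¹' (closure (β ⁻¹' (T \ {w (o k)})) \ {w₁ (o k)})) \
      closure (βᵢ ⁻¹' ((β ⁻¹' {w (o k)} ∩ closure (β ⁻¹' (T \ {w (o k)}))) \ {w₁ (o k)})))), isClosed_closure⟩ : Closeds Y''') =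
      ⟨closure (closure (β' ⁻¹' (closure (βᵢ ⁻¹' (closure (β ⁻¹' (T \ {w (o k)})) \ {w₁ (o k)})) \
      closure (βᵢ ⁻¹' ((β ⁻¹' {w (o k)} ∩ closure (β ⁻¹' (T \ {w (o k)}))) \ {w₁ (o k)}))))), isClosed_closure⟩ := by
  apply Closeds.ext
  change closure _ = closure (closure _)
  rw [closure_closure]

end ThreeStep

section ThreeStepPublic

variable {k : Type} [Field k] [IsAlgClosed k]
variable {Y Y' Y'' Y''' : Scheme.{0}} [IsLocallyNoetherian Y]
  (w : Spec (CommRingCat.of (MvPolynomial (Fin 3) k)) ⟶ Y) [IsOpenImmersion w]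
  {y₀ : Y} (hy₀ : w (o k) = y₀) (hc : IsClosed ({y₀} : Set Y))
  {T : Set Y} (hTc : IsClosed T) (hTirr : IsIrreducible T)
  (hwT : (vanishingIdeal (⟨T, hTc⟩ : Closeds Y)).comap w =
    ofIdealTop ((Ideal.span {(X 2 ^ 2 + X 0 ^ 4 + X 1 ^ 4 : MvPolynomial (Fin 3) k)}).map
      (Scheme.ΓSpecIso (CommRingCat.of (MvPolynomial (Fin 3) k))).inv.hom))
  (hwo : y₀ ∈ T) (h2 : (2 : k) ≠ 0)
  {β : Y' ⟶ Y} (hβ : IsBlowup β (vanishingIdeal (⟨{y₀}, hc⟩ : Closeds Y)))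
  (w₁ : Spec (CommRingCat.of (MvPolynomial (Fin 3) k)) ⟶ Y') [IsOpenImmersion w₁]
  {y₁ : Y'} (hy₁ : w₁ (o k) = y₁) (hc₁ : IsClosed ({y₁} : Set Y'))
  (hw₁S : (vanishingIdeal (⟨closure (β ⁻¹' (T \ {y₀})), isClosed_closure⟩ : Closeds Y')).comap w₁ =
    ofIdealTop ((Ideal.span {gL k}).map (Scheme.ΓSpecIso (CommRingCat.of (MvPolynomial (Fin 3) k))).inv.hom))
  (hw₁Z : (vanishingIdeal (⟨β ⁻¹' {y₀} ∩ closure (β ⁻¹' (T \ {y₀})), isClosed_inter hc β⟩ : Closeds Y')).comap w₁ =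
    ofIdealTop ((Ideal.span (Set.range (WhitneyCubic.cen k))).map (Scheme.ΓSpecIso (CommRingCat.of (MvPolynomial (Fin 3) k))).inv.hom))
  (hw₁o : y₁ ∈ β ⁻¹' {y₀} ∩ closure (β ⁻¹' (T \ {y₀})))
  {βᵢ : Y'' ⟶ Y'} (hβᵢ : IsBlowup βᵢ (vanishingIdeal (⟨{y₁}, hc₁⟩ : Closeds Y')))
  {β' : Y''' ⟶ Y''}
  (hβ' : IsBlowup β' (vanishingIdeal (⟨closure (βᵢ ⁻¹' ((β ⁻¹' {y₀} ∩ closure (β ⁻¹' (T \ {y₀}))) \ {y₁})),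
    isClosed_closure⟩ : Closeds Y'')))

include hy₀ hy₁ hTirr hwT hwo h2 hβ hw₁S hw₁Z hw₁o hβᵢ hβ' in
/-- **GLOBAL THREE-STEP REGULARITY (1), «double closure» spelling, centres as variables.** [OURS · L1 W4.5b · SPECIMEN-TC⁺ (i)]
[cite: StacksProject, Tag 080E] -/
theorem isRegularLocalRing_threeStep_of_mem_range'
    (z : (vanishingIdeal (⟨closure (closure (β' ⁻¹' (closure (βᵢ ⁻¹' (closure (β ⁻¹' (T \ {y₀})) \ {y₁})) \
      closure (βᵢ ⁻¹' ((β ⁻¹' {y₀} ∩ closure (β ⁻¹' (T \ {y₀}))) \ {y₁}))))), isClosed_closure⟩ : Closeds Y''')).subscheme)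
    (hz : β (βᵢ (β' ((vanishingIdeal (⟨closure (closure (β' ⁻¹' (closure (βᵢ ⁻¹' (closure (β ⁻¹' (T \ {y₀})) \ {y₁})) \
      closure (βᵢ ⁻¹' ((β ⁻¹' {y₀} ∩ closure (β ⁻¹' (T \ {y₀}))) \ {y₁}))))), isClosed_closure⟩ : Closeds Y''')).subschemeι z))) ∈
      Set.range w) :
    IsRegularLocalRing ((vanishingIdeal (⟨closure (closure (β' ⁻¹' (closure (βᵢ ⁻¹' (closure (β ⁻¹' (T \ {y₀})) \ {y₁})) \
      closure (βᵢ ⁻¹' ((β ⁻¹' {y₀} ∩ closure (β ⁻¹' (T \ {y₀}))) \ {y₁}))))), isClosed_closure⟩ :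
        Closeds Y''')).subscheme.presheaf.stalk z) := by
  subst hy₀ hy₁
  have H := isRegularLocalRing_threeStep_of_mem_range (w := w) (hc := hc) (hTc := hTc) (hTirr := hTirr) (hwT := hwT) (hwo := hwo)
    (h2 := h2) (hβ := hβ) (w₁ := w₁) (hc₁ := hc₁) (hw₁S := hw₁S) (hw₁Z := hw₁Z) (hw₁o := hw₁o) (hβᵢ := hβᵢ) (hβ' := hβ')
  rw [closeds_threeStep_eq' w w₁ (T := T) (β := β) (βᵢ := βᵢ) β'] at H
  exact H z hz

omit [IsAlgClosed k] [IsLocallyNoetherian Y] [IsOpenImmersion w] [IsOpenImmersion w₁] in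
include hy₀ hy₁ hTc hβ hw₁o hβᵢ hβ' in
/-- **GLOBAL THREE-STEP REGULARITY (2), «double closure» spelling, centres as variables.** [OURS · L1 W4.5b · SPECIMEN-TC⁺ (i)]
[cite: GortzWedhorn2020, Prop. 13.91] -/
theorem isRegularLocalRing_threeStep_of_mem_open' (O : Y.Opens) (hO : y₀ ∉ O)
    (hregO : ∀ x : (vanishingIdeal (⟨closure T, isClosed_closure⟩ : Closeds Y)).subscheme,
      (vanishingIdeal (⟨closure T, isClosed_closure⟩ : Closeds Y)).subschemeι x ∈ O →
      IsRegularLocalRing ((vanishingIdeal (⟨closure T, isClosed_closure⟩ : Closeds Y)).subscheme.presheaf.stalk x))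
    (z : (vanishingIdeal (⟨closure (closure (β' ⁻¹' (closure (βᵢ ⁻¹' (closure (β ⁻¹' (T \ {y₀})) \ {y₁})) \
      closure (βᵢ ⁻¹' ((β ⁻¹' {y₀} ∩ closure (β ⁻¹' (T \ {y₀}))) \ {y₁}))))), isClosed_closure⟩ : Closeds Y''')).subscheme)
    (hz : β (βᵢ (β' ((vanishingIdeal (⟨closure (closure (β' ⁻¹' (closure (βᵢ ⁻¹' (closure (β ⁻¹' (T \ {y₀})) \ {y₁})) \
      closure (βᵢ ⁻¹' ((β ⁻¹' {y₀} ∩ closure (β ⁻¹' (T \ {y₀}))) \ {y₁}))))), isClosed_closure⟩ : Closeds Y''')).subschemeι z))) ∈ O) :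
    IsRegularLocalRing ((vanishingIdeal (⟨closure (closure (β' ⁻¹' (closure (βᵢ ⁻¹' (closure (β ⁻¹' (T \ {y₀})) \ {y₁})) \
      closure (βᵢ ⁻¹' ((β ⁻¹' {y₀} ∩ closure (β ⁻¹' (T \ {y₀}))) \ {y₁}))))), isClosed_closure⟩ :
        Closeds Y''')).subscheme.presheaf.stalk z) := by
  subst hy₀ hy₁
  have H := isRegularLocalRing_threeStep_of_mem_open (w := w) (hc := hc) (hTc := hTc) (hβ := hβ) (w₁ := w₁) (hc₁ := hc₁)
    (hw₁o := hw₁o) (hβᵢ := hβᵢ) (hβ' := hβ') O hO hregO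
  rw [closeds_threeStep_eq' w w₁ (T := T) (β := β) (βᵢ := βᵢ) β'] at H
  exact H z hz

end ThreeStepPublic

end SpecimenQuarticTcPlus

end Summit.ResolutionOfSingularities.ResolutionOfSingularities.Cruxes.EquisingularLiftNat.Sections
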